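import Summits.HubbardSuperconductivity.HubbardSuperconductivity.Theorems.NodalDiracTwistBridgeNodalToDWaveRealMomentum

/-!
# Route `NodalDiracTwist`, crux `BridgeNodalToDWave` (stmt-HubbardSuperconductivity-10395) —
# helper: the unique untwisted sector ground state has crystal momentum `0` or `(π,π)`

Line `birth`, lead c11 (`--supports stmt-HubbardSuperconductivity-10395`), sequel of
`NodalDiracTwistBridgeNodalToDWaveRealMomentum`.  There it is proved that a unique `(N, S^z = 0)`
sector ground state `χ` of the Hubbard torus is a `±1` eigenvector of every translation `U_v` and of
every point-group operation `U_γ`, `γ ∈ D₄`.  Here the two are combined through the semidirect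
product relation of the space group, `γ ∘ τ_v = τ_{γ v} ∘ γ` (`d4Perm_mul_translate`): conjugating by
the quarter rotation `r` shows that the translation eigenvalues along the two axes COINCIDE
(`hubbardTorus_fockTranslate_single_zero_eq_single_one`), i.e. the crystal momentum of `χ` is
`(0,0)` or `(π,π)` — lead c9's audit item S3 for the state in the conclusion of stub C, now
kernel-checked.  Sources: D. J. Scalapino, Phys. Rep. 250 (1995) 329, §2 (space group of the square
lattice); Y. Hatsugai, J. Phys. Soc. Jpn. 75 (2006) 123601.  No new definitions, no named facts.
-/

-- the mandated namespace `Summit.<Summit>.<Problem>.Theorems` repeats `HubbardSuperconductivity`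
set_option linter.dupNamespace false

noncomputable section

namespace Summit.HubbardSuperconductivity.HubbardSuperconductivity.Theorems.NodalDiracTwist.BridgeNodalToDWave

open Matrix Literature.MathematicalPhysics.QuantumLattice Literature.Probability.LatticeModels
open Summit.HubbardSuperconductivity.HubbardSuperconductivity.Theorems.NodalDiracTwist
open scoped ComplexOrder

variable {L : ℕ} [NeZero L]

/-- **The space-group relation on orbitals**: `γ ∘ τ_v = τ_{γ v} ∘ γ` for `γ ∈ D₄` (a linear map of
the torus, `d4Site_add`) and a translation `τ_v`. Scalapino (1995) §2. [folklore] -/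
theorem d4Perm_mul_translate (γ : DihedralGroup 4) (v : TorusSite 2 L) :
    Orb.d4Perm γ * Orb.translate v = Orb.translate (d4Site γ v) * Orb.d4Perm (L := L) γ := by
  ext o : 1
  rw [Equiv.Perm.mul_apply, Equiv.Perm.mul_apply]
  change Orb.d4Perm γ (Orb.translate v (orb (ofLex o).1 (ofLex o).2)) =
    Orb.translate (d4Site γ v) (Orb.d4Perm γ (orb (ofLex o).1 (ofLex o).2))
  rw [← FermionTorus.ofTorusSite_toTorusSite (ofLex o).1, Orb.translate_orb, Orb.d4Perm_orb,
    Orb.d4Perm_orb, Orb.translate_orb, d4Site_add]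

/-- The same relation for the Fock-space unitaries: `U_γ U_v = U_{γ v} U_γ`. [folklore] -/
theorem fockD4_val_mul_fockTranslate_val (γ : DihedralGroup 4) (v : TorusSite 2 L) :
    (fockD4 (L := L) γ).val * (fockTranslate v).val =
      (fockTranslate (d4Site γ v)).val * (fockD4 (L := L) γ).val := by
  have h : fockD4 (L := L) γ * fockTranslate v = fockTranslate (d4Site γ v) * fockD4 (L := L) γ := by
    rw [fockD4_apply, fockTranslate, fockTranslate, ← map_mul, d4Perm_mul_translate, map_mul]
  exact congrArg Subtype.val h

/-- **Translation eigenvalues of a `D₄`-symmetric translation eigenvector are `D₄` invariant.**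
If `U_γ χ = η χ` with `χ ≠ 0`… more precisely: if `χ ≠ 0`, `U_γ χ = η • χ`, `U_v χ = a • χ` and
`U_{γ v} χ = b • χ`, then `a = b`. [folklore] -/
theorem translate_eigenvalue_eq_of_fockD4 (γ : DihedralGroup 4) (v : TorusSite 2 L)
    {χ : Fock (Orb (FermionTorus 2 L))} (hχ0 : χ ≠ 0) {η a b : ℂ} (hη : η ≠ 0)
    (hγ : (fockD4 (L := L) γ).val *ᵥ χ = η • χ) (ha : (fockTranslate v).val *ᵥ χ = a • χ)
    (hb : (fockTranslate (d4Site γ v)).val *ᵥ χ = b • χ) : a = b := by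
  have h1 : (fockD4 (L := L) γ).val *ᵥ ((fockTranslate v).val *ᵥ χ) =
      (fockTranslate (d4Site γ v)).val *ᵥ ((fockD4 (L := L) γ).val *ᵥ χ) := by
    rw [mulVec_mulVec, mulVec_mulVec, fockD4_val_mul_fockTranslate_val]
  rw [ha, mulVec_smul, hγ, mulVec_smul, hb, smul_smul, smul_smul] at h1
  have h2 : (a * η - η * b) • χ = 0 := by rw [sub_smul, h1, sub_self]
  have h3 : a * η - η * b = 0 := by
    by_contra hne
    exact hχ0 ((smul_eq_zero.1 h2).resolve_left hne)
  have h4 : η * a = η * b := by rw [mul_comm η a]; exact sub_eq_zero.1 h3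
  exact mul_left_cancel₀ hη h4

/-- **The unique untwisted sector ground state has crystal momentum `0` or `(π,π)`.**  For `3 ≤ L`,
if the `(N, S^z = 0)` sector ground state `χ` of `hubbardTorus 2 L 1 U` is unique up to scalars,
then the unit translations along the two axes act on `χ` by the SAME sign:
`U_{e₁} χ = U_{e₂} χ (= ± χ)`.  Proof: `U_r U_{e₁} U_r⁻¹ = U_{r e₁} = U_{e₂}` for the quarter rotation
`r ∈ D₄`, and `χ` is an eigenvector of `U_r` (`hubbardTorus_fockD4_mulVec_eq_self_or_eq_neg`).
Scalapino (1995) §2; Hatsugai (2006). [folklore] -/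
theorem hubbardTorus_fockTranslate_single_zero_eq_single_one (hL : 3 ≤ L) {U : ℝ} {N : ℕ}
    {χ : Fock (Orb (FermionTorus 2 L))}
    (hχ : IsGroundStateInSector (hubbardTorus 2 L 1 U) N 0 χ)
    (huniq : ∀ χ', IsGroundStateInSector (hubbardTorus 2 L 1 U) N 0 χ' → ∃ z : ℂ, χ' = z • χ) :
    (fockTranslate (Pi.single 0 1 : TorusSite 2 L)).val *ᵥ χ =
      (fockTranslate (Pi.single 1 1 : TorusSite 2 L)).val *ᵥ χ := by
  have hχ0 : χ ≠ 0 := hχ.2.1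
  -- eigenvalues: `U_r χ = η χ`, `U_{e₁} χ = a χ`, `U_{e₂} χ = b χ`, all signs
  have hrot : d4Site (DihedralGroup.r 1) (Pi.single 0 1 : TorusSite 2 L) = Pi.single 1 1 := by
    have hv : (1 : ZMod 4).val = 1 := rfl
    funext k
    fin_cases k <;> simp [d4Site, hv, rotSite]
  obtain ⟨η, hη, hγ⟩ : ∃ η : ℂ, η ≠ 0 ∧ (fockD4 (L := L) (DihedralGroup.r 1)).val *ᵥ χ = η • χ := by
    rcases hubbardTorus_fockD4_mulVec_eq_self_or_eq_neg L hL hχ huniq (DihedralGroup.r 1) with h | h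
    · exact ⟨1, one_ne_zero, by rw [h, one_smul]⟩
    · exact ⟨-1, neg_ne_zero.2 one_ne_zero, by rw [h, neg_one_smul]⟩
  obtain ⟨a, ha⟩ : ∃ a : ℂ, (fockTranslate (Pi.single 0 1 : TorusSite 2 L)).val *ᵥ χ = a • χ := by
    rcases hubbardTorus_fockTranslate_mulVec_eq_self_or_eq_neg L hL hχ huniq (Pi.single 0 1) with h | h
    · exact ⟨1, by rw [h, one_smul]⟩
    · exact ⟨-1, by rw [h, neg_one_smul]⟩
  obtain ⟨b, hb⟩ : ∃ b : ℂ, (fockTranslate (Pi.single 1 1 : TorusSite 2 L)).val *ᵥ χ = b • χ := by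
    rcases hubbardTorus_fockTranslate_mulVec_eq_self_or_eq_neg L hL hχ huniq (Pi.single 1 1) with h | h
    · exact ⟨1, by rw [h, one_smul]⟩
    · exact ⟨-1, by rw [h, neg_one_smul]⟩
  have hb' : (fockTranslate (d4Site (DihedralGroup.r 1) (Pi.single 0 1 : TorusSite 2 L))).val *ᵥ χ =
      b • χ := by rw [hrot]; exact hb
  have hab : a = b := translate_eigenvalue_eq_of_fockD4 (DihedralGroup.r 1) _ hχ0 hη hγ ha hb'
  rw [ha, hb, hab]

/-- **Corollary (momentum `0` or `(π,π)`, disjunctive form).**  Under the same hypotheses, either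
both unit translations fix `χ` (momentum `(0,0)`) or both reverse its sign (momentum `(π,π)`).
Scalapino (1995) §2; Hatsugai (2006). [folklore] -/
theorem hubbardTorus_momentum_zero_or_pi_pi (hL : 3 ≤ L) {U : ℝ} {N : ℕ}
    {χ : Fock (Orb (FermionTorus 2 L))}
    (hχ : IsGroundStateInSector (hubbardTorus 2 L 1 U) N 0 χ)
    (huniq : ∀ χ', IsGroundStateInSector (hubbardTorus 2 L 1 U) N 0 χ' → ∃ z : ℂ, χ' = z • χ) :
    ((fockTranslate (Pi.single 0 1 : TorusSite 2 L)).val *ᵥ χ = χ ∧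
        (fockTranslate (Pi.single 1 1 : TorusSite 2 L)).val *ᵥ χ = χ) ∨
      ((fockTranslate (Pi.single 0 1 : TorusSite 2 L)).val *ᵥ χ = -χ ∧
        (fockTranslate (Pi.single 1 1 : TorusSite 2 L)).val *ᵥ χ = -χ) := by
  have heq := hubbardTorus_fockTranslate_single_zero_eq_single_one hL hχ huniq
  rcases hubbardTorus_fockTranslate_mulVec_eq_self_or_eq_neg L hL hχ huniq (Pi.single 0 1) with h | h
  · exact Or.inl ⟨h, heq ▸ h⟩
  · exact Or.inr ⟨h, heq ▸ h⟩

/-- **Registered sub-goal `stub_untwistedMomentumZeroOrPiPi` of crux stmt-HubbardSuperconductivity-10395**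
(lead c11, line `birth`; structural input to stub C): the statement of
`hubbardTorus_momentum_zero_or_pi_pi` with all binders explicit and all names fully qualified —
the unique untwisted `(N, S^z = 0)` sector ground state of `hubbardTorus 2 L 1 U` (`3 ≤ L`) has
crystal momentum `(0,0)` or `(π,π)`. Scalapino (1995) §2; Hatsugai (2006). [folklore] -/
theorem stub_untwistedMomentumZeroOrPiPi : ∀ (L : ℕ) [NeZero L], 3 ≤ L → ∀ (U : ℝ) (N : ℕ) (χ : Literature.MathematicalPhysics.QuantumLattice.Fock (Literature.MathematicalPhysics.QuantumLattice.Orb (Literature.MathematicalPhysics.QuantumLattice.FermionTorus 2 L))), Literature.MathematicalPhysics.QuantumLattice.IsGroundStateInSector (Literature.MathematicalPhysics.QuantumLattice.hubbardTorus 2 L 1 U) N 0 χ → (∀ χ' : Literature.MathematicalPhysics.QuantumLattice.Fock (Literature.MathematicalPhysics.QuantumLattice.Orb (Literature.MathematicalPhysics.QuantumLattice.FermionTorus 2 L)), Literature.MathematicalPhysics.QuantumLattice.IsGroundStateInSector (Literature.MathematicalPhysics.QuantumLattice.hubbardTorus 2 L 1 U) N 0 χ' → ∃ z : ℂ, χ'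 = z • χ) → (Matrix.mulVec (Literature.MathematicalPhysics.QuantumLattice.fockTranslate (Pi.single 0 1 : Literature.Probability.LatticeModels.TorusSite 2 L)).val χ = χ ∧ Matrix.mulVec (Literature.MathematicalPhysics.QuantumLattice.fockTranslate (Pi.single 1 1 : Literature.Probability.LatticeModels.TorusSite 2 L)).val χ = χ) ∨ (Matrix.mulVec (Literature.MathematicalPhysics.QuantumLattice.fockTranslate (Pi.single 0 1 : Literature.Probability.LatticeModels.TorusSite 2 L)).val χ = -χ ∧ Matrix.mulVec (Literature.MathematicalPhysics.QuantumLattice.fockTranslate (Pi.single 1 1 : Literature.Probability.LatticeModels.TorusSite 2 L)).val χ = -χ) :=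
  fun _ _ hL _ _ _ hχ huniq => hubbardTorus_momentum_zero_or_pi_pi hL hχ huniq

end Summit.HubbardSuperconductivity.HubbardSuperconductivity.Theorems.NodalDiracTwist.BridgeNodalToDWave

end
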